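import Summits.AtomisticToContinuum.HydrodynamicLimit.Theorems.LambertianContactSwapSwapGapEntropyBudgetStatics
import HarnessLib

/-!
# `SwapGap` (stmt-AtomisticToContinuum-11850), line `Sketch`: two-sided domination of a local Gibbs law by the standard homogeneous Gibbs law

Helper file (`--supports`) for the crux
`Summit.AtomisticToContinuum.HydrodynamicLimit.Theses.LambertianContactSwap.SwapGap`, line `Sketch`
(entropy relative to the Lambertian law), registered stub S1 `stub_relEntSwap`.  Statics for the
ENTROPY BUDGET RELATIVE TO THE LAMBERTIAN LAW (sequel `…SwapGapRelEntBudget`): for continuous profiles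
`a₀, θ₀ > 0`, `u₀` and `σ ≤ 1/2` there are constants `A, b ≥ 0` such that, with
`P_N = localGibbsLaw σ a₀ u₀ θ₀ N Φ` and the STANDARD HOMOGENEOUS Gibbs law `G_N = localGibbsLaw σ 1 0 1 N Φ`
(unit activity, zero drift, unit temperature; invariant under every hard-sphere flow),

* `exists_abs_log_canonicalDensity_sub_le` — on the hard-sphere domain
  `|log ρ_{P_N}(z) - log ρ_{G_N}(z)| ≤ A (N+1) + b E(z)`, `E(z) = ½ ∑ᵢ |vᵢ|²` (partition functions
  compared by `exists_abs_log_posPartition_sub_le`; the Gaussian part is affine in `|vᵢ|²` with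
  bounded coefficients);
* `exists_localGibbsLaw_dominated` — hence the two-sided ENERGY-TILTED domination
  `G_N · e^{-(A(N+1) + bE)} ≤ P_N ≤ G_N · e^{A(N+1) + bE}`, the pinned-entropy budget
  `KL(P_N ‖ G_N) ≤ A (N+1)` and the second-moment bound `E_{P_N}[E] ≤ A (N+1)`, for every `N` and
  every flow `Φ`.

Kipnis–Landim 1999, Ch. 6 §1 (`H(μ^N | ν^N) ≤ C N` for local equilibrium data); Spohn 1991 Part I
§2.3.  prover-line-stmt-AtomisticToContinuum-11850-c1-0 (line lead c1), cycle 2 of the line.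
-/

noncomputable section

open MeasureTheory Filter Set Topology InformationTheory
open scoped ENNReal

namespace Summit.AtomisticToContinuum.HydrodynamicLimit.Theorems.LambertianContactSwapSwapGapGibbsDomination

open Literature.Analysis.FluidPDE Literature.MathematicalPhysics.KineticTheory
open Summit.AtomisticToContinuum.HydrodynamicLimit.Theorems

/-! ### Part A — pointwise comparison of a local Gibbs density with the standard homogeneous one -/

/-- Elementary: `‖v‖² ≤ 2‖v - u‖² + 2‖u‖²`. [folklore] -/
private theorem norm_sq_le_two_mul_add (v u : V3) : ‖v‖ ^ 2 ≤ 2 * ‖v - u‖ ^ 2 + 2 * ‖u‖ ^ 2 := by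
  have h : ‖v‖ ≤ ‖v - u‖ + ‖u‖ := by
    calc ‖v‖ = ‖(v - u) + u‖ := by rw [sub_add_cancel]
      _ ≤ ‖v - u‖ + ‖u‖ := norm_add_le _ _
  have h0 : 0 ≤ ‖v‖ := norm_nonneg _
  nlinarith [norm_nonneg (v - u), norm_nonneg u, sq_nonneg (‖v - u‖ - ‖u‖)]

/-- **Pointwise comparison of a local Gibbs density with the standard homogeneous one.** For
continuous profiles `a₀, θ₀ > 0`, `u₀` and `σ ≤ 1/2` there are constants `A, b ≥ 0` such that on
the hard-sphere domain, for every `N`,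
`|log ρ_{a₀,u₀,θ₀}(z) - log ρ_{1,0,1}(z)| ≤ A (N+1) + b E(z)`, `E(z) = ½ ∑ᵢ |vᵢ|²` the kinetic
energy (`ρ_{1,0,1}` = canonical density with unit activity, zero drift, unit temperature).
[folklore] -/
theorem exists_abs_log_canonicalDensity_sub_le {a₀ θ₀ : T3 → ℝ} {u₀ : T3 → V3}
    (ha : Continuous a₀) (hθ : Continuous θ₀) (hu : Continuous u₀) (ha0 : ∀ x, 0 < a₀ x)
    (hθ0 : ∀ x, 0 < θ₀ x) {σ : ℝ} (hσ2 : σ ≤ 1 / 2) :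
    ∃ A b : ℝ, 0 ≤ A ∧ 0 ≤ b ∧ ∀ (N : ℕ) (z : Config (N + 1) (Fin 3) T3),
      z ∈ hardSphereDomain (Torus.geometry (Fin 3)) (N + 1) (hsDiameter σ N) →
        |Real.log (canonicalDensity (Torus.geometry (Fin 3)) (hsDiameter σ N) (N + 1)
              (localGibbsProfile a₀ u₀ θ₀) z) -
            Real.log (canonicalDensity (Torus.geometry (Fin 3)) (hsDiameter σ N) (N + 1)
              (localGibbsProfile (fun _ => 1) (fun _ => 0) (fun _ => 1)) z)| ≤
          A * ((N : ℝ) + 1) + b * configEnergy z := by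
  -- bounds on the profiles over the compact torus
  obtain ⟨θm, hθm0, hθm⟩ := exists_pos_le_of_continuous hθ hθ0
  obtain ⟨Ka, hKa0, hKa⟩ := exists_abs_log_le_of_continuous ha ha0
  have h2π : ∀ x, 0 < 2 * Real.pi * θ₀ x := fun x => by have := hθ0 x; positivity
  obtain ⟨Kθ, hKθ0, hKθ⟩ := exists_abs_log_le_of_continuous (f := fun x => 2 * Real.pi * θ₀ x)
    (continuous_const.mul hθ) h2π
  obtain ⟨U, hU⟩ := exists_le_of_continuous hu.norm
  have hU0 : 0 ≤ U := (norm_nonneg _).trans (hU 0)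
  obtain ⟨K, hK0, hK⟩ := exists_abs_log_posPartition_sub_le (a := a₀) (b := fun _ => (1 : ℝ)) ha
    continuous_const ha0 (fun _ => one_pos) hσ2
  set Kr : ℝ := |Real.log (2 * Real.pi * 1)| with hKr
  set K₂ : ℝ := Ka + 3 / 2 * (Kr + Kθ) + U ^ 2 / θm with hK₂
  have hK₂0 : 0 ≤ K₂ := by positivity
  refine ⟨K + K₂, 1 + 2 / θm, by positivity, by positivity, fun N z hz => ?_⟩
  rw [log_canonicalDensity_localGibbsProfile_eq ha hθ hu ha0 hθ0 hσ2 N hz,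
    log_canonicalDensity_localGibbsProfile_eq (a := fun _ => (1 : ℝ)) (θ := fun _ => (1 : ℝ))
      (u := fun _ => (0 : V3)) continuous_const continuous_const continuous_const
      (fun _ => one_pos) (fun _ => one_pos) hσ2 N hz]
  beta_reduce
  -- per-particle bounds
  have hpart : ∀ i : Fin (N + 1),
      (Real.log (a₀ (z i).1) + (-(3 / 2) * Real.log (2 * Real.pi * θ₀ (z i).1) -
          ‖(z i).2 - u₀ (z i).1‖ ^ 2 / (2 * θ₀ (z i).1))) -
        (Real.log (1 : ℝ) + (-(3 / 2) * Real.log (2 * Real.pi * 1) -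
          ‖(z i).2 - (0 : V3)‖ ^ 2 / (2 * 1))) ≤ K₂ + ‖(z i).2‖ ^ 2 / 2 ∧
      -K₂ - ‖(z i).2‖ ^ 2 / θm ≤
      (Real.log (a₀ (z i).1) + (-(3 / 2) * Real.log (2 * Real.pi * θ₀ (z i).1) -
          ‖(z i).2 - u₀ (z i).1‖ ^ 2 / (2 * θ₀ (z i).1))) -
        (Real.log (1 : ℝ) + (-(3 / 2) * Real.log (2 * Real.pi * 1) -
          ‖(z i).2 - (0 : V3)‖ ^ 2 / (2 * 1))) := by
    intro i
    set x := (z i).1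
    set v := (z i).2
    have hθx : 0 < θ₀ x := hθ0 x
    have hθx1 : θm ≤ θ₀ x := hθm x
    have ha1 := abs_le.1 (hKa x)
    have hθ1 : -Kθ ≤ Real.log (2 * Real.pi * θ₀ x) ∧ Real.log (2 * Real.pi * θ₀ x) ≤ Kθ :=
      abs_le.1 (hKθ x)
    have hr1 : -Kr ≤ Real.log (2 * Real.pi * 1) ∧ Real.log (2 * Real.pi * 1) ≤ Kr :=
      abs_le.1 (le_refl Kr)
    have hux : ‖u₀ x‖ ≤ U := hU x
    have hux2 : ‖u₀ x‖ ^ 2 ≤ U ^ 2 := pow_le_pow_left₀ (norm_nonneg _) hux 2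
    rw [sub_zero, Real.log_one]
    set d := ‖v - u₀ x‖ ^ 2 with hd
    set n := ‖v‖ ^ 2 with hn'
    have hd0 : 0 ≤ d := sq_nonneg _
    have hn0 : 0 ≤ n := sq_nonneg _
    -- the velocity part: `-(n + U²)/θm ≤ -d/(2θ₀) + n/2 ≤ n/2`
    have hv_up : -(d / (2 * θ₀ x)) + n / (2 * 1) ≤ n / 2 := by
      have h1 : 0 ≤ d / (2 * θ₀ x) := by positivity
      have h2 : n / (2 * 1) = n / 2 := by rw [mul_one]
      linarith
    have hv_lo : -(n / θm) - U ^ 2 / θm ≤ -(d / (2 * θ₀ x)) + n / (2 * 1) := by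
      have h1 : 0 ≤ n / (2 * 1) := by positivity
      have h2 : d / (2 * θ₀ x) ≤ (n + ‖u₀ x‖ ^ 2) / θ₀ x := by
        rw [div_le_div_iff₀ (by positivity) hθx]
        have : d ≤ 2 * n + 2 * ‖u₀ x‖ ^ 2 := by
          have := norm_sq_le_two_mul_add (v - u₀ x) v
          rw [sub_sub_cancel_left, norm_neg] at this
          linarith [this]
        nlinarith
      have h3 : (n + ‖u₀ x‖ ^ 2) / θ₀ x ≤ (n + U ^ 2) / θm :=
        div_le_div₀ (by positivity) (by linarith) hθm0 hθx1
      have h4 : (n + U ^ 2) / θm = n / θm + U ^ 2 / θm := add_div _ _ _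
      linarith
    have hU2 : 0 ≤ U ^ 2 / θm := by positivity
    constructor
    · rw [hK₂]; linarith [ha1.1, ha1.2, hθ1.1, hθ1.2, hr1.1, hr1.2]
    · rw [hK₂]; linarith [ha1.1, ha1.2, hθ1.1, hθ1.2, hr1.1, hr1.2]
  -- summing the per-particle bounds
  have hE1 : configEnergy z = ∑ i : Fin (N + 1), ‖(z i).2‖ ^ 2 / 2 := by
    unfold configEnergy
    rw [Finset.mul_sum]
    refine Finset.sum_congr rfl fun i _ => ?_
    ring
  have hE2 : 2 / θm * configEnergy z = ∑ i : Fin (N + 1), ‖(z i).2‖ ^ 2 / θm := by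
    unfold configEnergy
    rw [Finset.mul_sum, Finset.mul_sum]
    refine Finset.sum_congr rfl fun i _ => ?_
    field_simp
  have hsum_up : ∑ i : Fin (N + 1),
      ((Real.log (a₀ (z i).1) + (-(3 / 2) * Real.log (2 * Real.pi * θ₀ (z i).1) -
          ‖(z i).2 - u₀ (z i).1‖ ^ 2 / (2 * θ₀ (z i).1))) -
        (Real.log (1 : ℝ) + (-(3 / 2) * Real.log (2 * Real.pi * 1) -
          ‖(z i).2 - (0 : V3)‖ ^ 2 / (2 * 1)))) ≤ K₂ * ((N : ℝ) + 1) + configEnergy z := by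
    calc _ ≤ ∑ i : Fin (N + 1), (K₂ + ‖(z i).2‖ ^ 2 / 2) := Finset.sum_le_sum fun i _ => (hpart i).1
      _ = K₂ * ((N : ℝ) + 1) + configEnergy z := by
          rw [Finset.sum_add_distrib, hE1]
          simp [mul_comm]
  have hsum_lo : -(K₂ * ((N : ℝ) + 1)) - 2 / θm * configEnergy z ≤ ∑ i : Fin (N + 1),
      ((Real.log (a₀ (z i).1) + (-(3 / 2) * Real.log (2 * Real.pi * θ₀ (z i).1) -
          ‖(z i).2 - u₀ (z i).1‖ ^ 2 / (2 * θ₀ (z i).1))) -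
        (Real.log (1 : ℝ) + (-(3 / 2) * Real.log (2 * Real.pi * 1) -
          ‖(z i).2 - (0 : V3)‖ ^ 2 / (2 * 1)))) := by
    calc -(K₂ * ((N : ℝ) + 1)) - 2 / θm * configEnergy z
        = ∑ i : Fin (N + 1), (-K₂ - ‖(z i).2‖ ^ 2 / θm) := by
          rw [hE2, Finset.sum_sub_distrib]
          simp [mul_comm]
      _ ≤ _ := Finset.sum_le_sum fun i _ => (hpart i).2
  have hZ := abs_le.1 (hK N)
  have hE0 : 0 ≤ configEnergy z := by
    rw [hE1]; exact Finset.sum_nonneg fun i _ => by positivity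
  have hN : (0 : ℝ) ≤ (N : ℝ) + 1 := by positivity
  rw [Finset.sum_sub_distrib] at hsum_up hsum_lo
  rw [abs_le]
  constructor
  · nlinarith [hZ.1, hZ.2, mul_nonneg hK₂0 hN, mul_nonneg (show (0:ℝ) ≤ 2 / θm by positivity) hE0]
  · nlinarith [hZ.1, hZ.2, mul_nonneg hK₂0 hN, mul_nonneg (show (0:ℝ) ≤ 2 / θm by positivity) hE0]

/-! ### Part B — static dominations of the local Gibbs law by the standard homogeneous Gibbs law -/

/-- **Two-sided energy-tilted domination of a local Gibbs law by the standard homogeneous Gibbs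
law, and the pinned entropy budget.** For continuous profiles `a₀, θ₀ > 0`, `u₀` and `σ ≤ 1/2` there
are constants `A, b ≥ 0` such that, with `P_N = localGibbsLaw σ a₀ u₀ θ₀ N Φ` and
`G_N = localGibbsLaw σ 1 0 1 N Φ` (unit activity, zero drift, unit temperature; invariant under every
hard-sphere flow), for every `N` and `Φ`:
`P_N ≤ G_N · e^{A(N+1) + b E}`, `G_N · e^{-(A(N+1) + b E)} ≤ P_N` (`E` the kinetic energy),
`KL(P_N ‖ G_N) ≤ A (N+1)`, and `E` is `P_N`-integrable with `E_{P_N}[E] ≤ A (N+1)`.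
[cite: KipnisLandim1999, Ch. 6 §1] -/
theorem exists_localGibbsLaw_dominated {a₀ θ₀ : T3 → ℝ} {u₀ : T3 → V3} (ha : Continuous a₀)
    (hθ : Continuous θ₀) (hu : Continuous u₀) (ha0 : ∀ x, 0 < a₀ x) (hθ0 : ∀ x, 0 < θ₀ x)
    {σ : ℝ} (hσ2 : σ ≤ 1 / 2) :
    ∃ A b : ℝ, 0 ≤ A ∧ 0 ≤ b ∧ ∀ (N : ℕ)
      (Φ : HardSphereFlow (Torus.geometry (Fin 3)) (hsDiameter σ N) (N + 1)),
      localGibbsLaw σ a₀ u₀ θ₀ N Φ ≤ (localGibbsLaw σ (fun _ => 1) (fun _ => 0) (fun _ => 1) N Φ).withDensity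
          (fun z => ENNReal.ofReal (Real.exp (A * ((N : ℝ) + 1) + b * configEnergy z))) ∧
      (localGibbsLaw σ (fun _ => 1) (fun _ => 0) (fun _ => 1) N Φ).withDensity
          (fun z => ENNReal.ofReal (Real.exp (-(A * ((N : ℝ) + 1) + b * configEnergy z)))) ≤
        localGibbsLaw σ a₀ u₀ θ₀ N Φ ∧
      klDiv (localGibbsLaw σ a₀ u₀ θ₀ N Φ)
          (localGibbsLaw σ (fun _ => 1) (fun _ => 0) (fun _ => 1) N Φ) ≤
        ENNReal.ofReal (A * ((N : ℝ) + 1)) ∧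
      Integrable (configEnergy : Config (N + 1) (Fin 3) T3 → ℝ) (localGibbsLaw σ a₀ u₀ θ₀ N Φ) ∧
      ∫ z, configEnergy z ∂(localGibbsLaw σ a₀ u₀ θ₀ N Φ) ≤ A * ((N : ℝ) + 1) := by
  obtain ⟨A₀, b, hA₀, hb, hbd⟩ := exists_abs_log_canonicalDensity_sub_le ha hθ hu ha0 hθ0 hσ2
  obtain ⟨C, hC0, hC⟩ := exists_lintegral_sum_norm_sq_localGibbsLaw_le ha hθ hu ha0 hθ0 hσ2
  set A : ℝ := A₀ + b * C + C with hA
  refine ⟨A, b, by positivity, hb, fun N Φ => ?_⟩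
  have hN : (0 : ℝ) ≤ (N : ℝ) + 1 := by positivity
  -- the two densities
  set ρP := canonicalDensity (Torus.geometry (Fin 3)) (hsDiameter σ N) (N + 1)
    (localGibbsProfile a₀ u₀ θ₀) with hρP
  set ρr := canonicalDensity (Torus.geometry (Fin 3)) (hsDiameter σ N) (N + 1)
    (localGibbsProfile (fun _ => (1 : ℝ)) (fun _ => (0 : V3)) (fun _ => (1 : ℝ))) with hρr
  have hρrm : Measurable ρr := measurable_canonicalDensity _ _
    (measurable_localGibbsProfile continuous_const continuous_const continuous_const)
  set D := hardSphereDomain (Torus.geometry (Fin 3)) (N + 1) (hsDiameter σ N) with hDdef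
  have hD : MeasurableSet D := measurableSet_hardSphereDomain _ Torus.measurable_geometry_sepVec _ _
  set L := liouville (Torus.geometry (Fin 3)) (N + 1) (hsDiameter σ N) with hLdef
  have haeD : ∀ᵐ z ∂L, z ∈ D := by
    rw [hLdef, liouville_eq]
    exact ae_restrict_mem hD
  set P := localGibbsLaw σ a₀ u₀ θ₀ N Φ with hPdef
  set Gr := localGibbsLaw σ (fun _ => (1 : ℝ)) (fun _ => (0 : V3)) (fun _ => (1 : ℝ)) N Φ with hGdef
  have hPL : P = L.withDensity fun z => ENNReal.ofReal (ρP z) := rfl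
  have hGL : Gr = L.withDensity fun z => ENNReal.ofReal (ρr z) := rfl
  haveI : IsProbabilityMeasure P := isProbabilityMeasure_localGibbsLaw ha hθ hu ha0 hθ0 hσ2 N Φ
  haveI : IsProbabilityMeasure Gr := isProbabilityMeasure_localGibbsLaw (a₀ := fun _ => (1 : ℝ))
    (θ₀ := fun _ => (1 : ℝ)) (u₀ := fun _ => (0 : V3)) continuous_const continuous_const
    continuous_const (fun _ => one_pos) (fun _ => one_pos) hσ2 N Φ
  have hEm : Measurable (configEnergy : Config (N + 1) (Fin 3) T3 → ℝ) := by
    unfold configEnergy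
    exact measurable_const.mul
      (Finset.measurable_sum _ fun i _ => ((measurable_pi_apply i).snd).norm.pow_const 2)
  have hE2 : ∀ z : Config (N + 1) (Fin 3) T3, configEnergy z = 2⁻¹ * ∑ i, ‖(z i).2‖ ^ 2 :=
    fun z => rfl
  have hE0 : ∀ z : Config (N + 1) (Fin 3) T3, 0 ≤ configEnergy z := fun z => by
    rw [hE2]; exact mul_nonneg (by norm_num) (Finset.sum_nonneg fun i _ => sq_nonneg _)
  -- the true tilt `V₀ = A₀ (N+1) + b E` and the exported one `V = A (N+1) + b E ≥ V₀`
  set V₀ : Config (N + 1) (Fin 3) T3 → ℝ := fun z => A₀ * ((N : ℝ) + 1) + b * configEnergy z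
    with hV₀
  set V : Config (N + 1) (Fin 3) T3 → ℝ := fun z => A * ((N : ℝ) + 1) + b * configEnergy z with hV
  have hV₀m : Measurable V₀ := (measurable_const.mul hEm).const_add _
  have hA₀A : A₀ ≤ A := by rw [hA]; nlinarith
  have hV₀V : ∀ z, V₀ z ≤ V z := fun z => by rw [hV₀, hV]; dsimp only; nlinarith
  -- pointwise bounds on `D`
  have hpt : ∀ z ∈ D, 0 < ρP z ∧ 0 < ρr z ∧
      Real.log (ρP z) - Real.log (ρr z) ≤ V₀ z ∧ -V₀ z ≤ Real.log (ρP z) - Real.log (ρr z) := by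
    intro z hz
    have h := abs_le.1 (hbd N z hz)
    exact ⟨canonicalDensity_localGibbsProfile_pos ha hθ hu ha0 hθ0 hσ2 N hz,
      canonicalDensity_localGibbsProfile_pos continuous_const continuous_const continuous_const
        (fun _ => one_pos) (fun _ => one_pos) hσ2 N hz, h.2, h.1⟩
  have hup_pt : ∀ z ∈ D, ρP z ≤ ρr z * Real.exp (V₀ z) := by
    intro z hz
    obtain ⟨hP0, hr0, h, -⟩ := hpt z hz
    calc ρP z = Real.exp (Real.log (ρP z)) := (Real.exp_log hP0).symm
      _ ≤ Real.exp (Real.log (ρr z) + V₀ z) := Real.exp_le_exp.2 (by linarith)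
      _ = ρr z * Real.exp (V₀ z) := by rw [Real.exp_add, Real.exp_log hr0]
  have hlo_pt : ∀ z ∈ D, ρr z * Real.exp (-V₀ z) ≤ ρP z := by
    intro z hz
    obtain ⟨hP0, hr0, -, h⟩ := hpt z hz
    calc ρr z * Real.exp (-V₀ z) = Real.exp (Real.log (ρr z) + -V₀ z) := by
          rw [Real.exp_add, Real.exp_log hr0]
      _ ≤ Real.exp (Real.log (ρP z)) := Real.exp_le_exp.2 (by linarith)
      _ = ρP z := Real.exp_log hP0
  -- (1) upper domination
  have hgum : Measurable fun z : Config (N + 1) (Fin 3) T3 => ENNReal.ofReal (Real.exp (V₀ z)) :=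
    (Real.measurable_exp.comp hV₀m).ennreal_ofReal
  have h1₀ : P ≤ Gr.withDensity fun z => ENNReal.ofReal (Real.exp (V₀ z)) := by
    rw [hGL, ← withDensity_mul _ hρrm.ennreal_ofReal hgum, hPL]
    refine withDensity_mono ?_
    filter_upwards [haeD] with z hz
    rw [Pi.mul_apply, ← ENNReal.ofReal_mul (hpt z hz).2.1.le]
    exact ENNReal.ofReal_le_ofReal (hup_pt z hz)
  have h1 : P ≤ Gr.withDensity fun z => ENNReal.ofReal (Real.exp (V z)) :=
    h1₀.trans (withDensity_mono (ae_of_all _ fun z =>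
      ENNReal.ofReal_le_ofReal (Real.exp_le_exp.2 (hV₀V z))))
  -- (2) lower domination
  have hglm : Measurable fun z : Config (N + 1) (Fin 3) T3 => ENNReal.ofReal (Real.exp (-V₀ z)) :=
    (Real.measurable_exp.comp hV₀m.neg).ennreal_ofReal
  have h2₀ : (Gr.withDensity fun z => ENNReal.ofReal (Real.exp (-V₀ z))) ≤ P := by
    rw [hGL, ← withDensity_mul _ hρrm.ennreal_ofReal hglm, hPL]
    refine withDensity_mono ?_
    filter_upwards [haeD] with z hz
    rw [Pi.mul_apply, ← ENNReal.ofReal_mul (hpt z hz).2.1.le]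
    exact ENNReal.ofReal_le_ofReal (hlo_pt z hz)
  have h2 : (Gr.withDensity fun z => ENNReal.ofReal (Real.exp (-V z))) ≤ P :=
    (withDensity_mono (ae_of_all _ fun z =>
      ENNReal.ofReal_le_ofReal (Real.exp_le_exp.2 (neg_le_neg (hV₀V z))))).trans h2₀
  -- second moments: integrability and the bound
  have hSm : Measurable fun z : Config (N + 1) (Fin 3) T3 => ∑ i, ‖(z i).2‖ ^ 2 :=
    Finset.measurable_sum _ fun i _ => ((measurable_pi_apply i).snd.norm).pow_const 2
  have hS0 : ∀ z : Config (N + 1) (Fin 3) T3, 0 ≤ ∑ i, ‖(z i).2‖ ^ 2 :=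
    fun z => Finset.sum_nonneg fun i _ => sq_nonneg _
  have hlin := hC N Φ
  have hSi : Integrable (fun z : Config (N + 1) (Fin 3) T3 => ∑ i, ‖(z i).2‖ ^ 2) P := by
    have h := integrable_toReal_of_lintegral_ne_top hSm.ennreal_ofReal.aemeasurable
      (ne_top_of_le_ne_top ENNReal.ofReal_ne_top hlin)
    refine h.congr (Eventually.of_forall fun z => ?_)
    exact ENNReal.toReal_ofReal (hS0 z)
  have hEdef : (configEnergy : Config (N + 1) (Fin 3) T3 → ℝ) = fun z => 2⁻¹ * ∑ i, ‖(z i).2‖ ^ 2 :=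
    funext hE2
  have hEi : Integrable (configEnergy : Config (N + 1) (Fin 3) T3 → ℝ) P := by
    rw [hEdef]
    exact hSi.const_mul _
  have hSint : ∫ z, ∑ i, ‖(z i).2‖ ^ 2 ∂P ≤ C * ((N : ℝ) + 1) := by
    have h := ofReal_integral_eq_lintegral_ofReal hSi (Eventually.of_forall hS0)
    rw [← ENNReal.ofReal_le_ofReal_iff (by positivity), h]
    exact hlin
  have hEint' : ∫ z, configEnergy z ∂P ≤ C / 2 * ((N : ℝ) + 1) := by
    rw [hEdef, integral_const_mul]
    nlinarith
  have hS0' : 0 ≤ ∫ z, configEnergy z ∂P := integral_nonneg hE0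
  have hEint : ∫ z, configEnergy z ∂P ≤ A * ((N : ℝ) + 1) := by
    rw [hA]
    nlinarith
  -- (3) the pinned entropy budget `KL(P ‖ Gr) ≤ A (N+1)`
  have hac : P ≪ Gr :=
    (Measure.absolutelyContinuous_of_le h1).trans (withDensity_absolutelyContinuous _ _)
  have hPLac : P ≪ L := withDensity_absolutelyContinuous _ _
  have haeDP : ∀ᵐ z ∂P, z ∈ D := hPLac.ae_le haeD
  have hllr : llr P Gr =ᵐ[P] fun z => Real.log (ρP z) - Real.log (ρr z) :=
    llr_localGibbsLaw_ae_eq ha hθ hu ha0 hθ0 (b := fun _ => (1 : ℝ)) (ϑ := fun _ => (1 : ℝ))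
      (w := fun _ => (0 : V3)) continuous_const continuous_const continuous_const
      (fun _ => one_pos) (fun _ => one_pos) hσ2 N Φ
  have hllr_bd : ∀ᵐ z ∂P, -V₀ z ≤ llr P Gr z ∧ llr P Gr z ≤ V₀ z := by
    filter_upwards [hllr, haeDP] with z hz hzD
    rw [hz]
    exact ⟨(hpt z hzD).2.2.2, (hpt z hzD).2.2.1⟩
  have hV₀i : Integrable V₀ P := (integrable_const _).add (hEi.const_mul b)
  have hint : Integrable (llr P Gr) P := by
    refine Integrable.mono' hV₀i (measurable_llr _ _).aestronglyMeasurable ?_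
    filter_upwards [hllr_bd] with z hz
    rw [Real.norm_eq_abs]
    exact abs_le.2 hz
  have hV₀int : ∫ z, V₀ z ∂P ≤ A * ((N : ℝ) + 1) := by
    rw [hV₀, integral_add (integrable_const _) (hEi.const_mul b), integral_const, probReal_univ,
      one_smul, integral_const_mul]
    have hbC : b * ∫ z, configEnergy z ∂P ≤ b * (C / 2 * ((N : ℝ) + 1)) :=
      mul_le_mul_of_nonneg_left hEint' hb
    rw [hA]
    nlinarith
  have h3 : klDiv P Gr ≤ ENNReal.ofReal (A * ((N : ℝ) + 1)) := by
    rw [klDiv_of_ac_of_integrable hac hint]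
    refine ENNReal.ofReal_le_ofReal ?_
    simp only [probReal_univ, add_sub_cancel_right]
    exact (integral_mono_ae hint hV₀i (hllr_bd.mono fun z hz => hz.2)).trans hV₀int
  exact ⟨h1, h2, h3, hEi, hEint⟩

end Summit.AtomisticToContinuum.HydrodynamicLimit.Theorems.LambertianContactSwapSwapGapGibbsDomination

end
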